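import Mathlib
import Literature.Geometry.Symplectic.JHolomorphicMap
import Summits.SmoothPoincare4.SmoothPoincare4.Theorems.SullivanDualTameOrBrodyR4AprioriCalculus
import Summits.SmoothPoincare4.SmoothPoincare4.Theorems.SullivanDualTameOrBrodyR4AprioriEnergy
import Summits.SmoothPoincare4.SmoothPoincare4.Theorems.SullivanDualTameOrBrodyR4AprioriAlpha
import Summits.SmoothPoincare4.SmoothPoincare4.Theorems.SullivanDualTameOrBrodyR4AprioriBeta
import Summits.SmoothPoincare4.SmoothPoincare4.Theorems.SullivanDualTameOrBrodyR4AprioriGamma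

/-!
# A-priori estimate for `J`-holomorphic maps: part 7, the bootstrapping induction

Helper file of the lead (c2) for stub `stub_aprioriOf` of line `Sketch`, crux `TameOrBrodyR4`
(stmt-SmoothPoincare4-7826, route SullivanDual). The induction (registered sub-goal `bootstrap`): on discs of radii `r t = δ/2 + δ/(2(t+2))`, each round `α, α, β, α, γ` turns sup bounds on the orders `≤ m + 1` into sup bounds on the orders `≤ m + 2`.
-/

noncomputable section

open scoped ContDiff Topology Nat
open Filter Set Literature.Geometry.Symplectic

-- the registered namespace `Summit.SmoothPoincare4.SmoothPoincare4.…` repeats a component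
set_option linter.dupNamespace false

namespace Summit.SmoothPoincare4.SmoothPoincare4.Cruxes.TameOrBrodyR4.Sketch

/-- Local notation for the model space `ℝ⁴ = EuclideanSpace ℝ (Fin 4)`. -/
local notation "E4" => EuclideanSpace ℝ (Fin 4)

namespace Apriori

/-! ### The bootstrapping induction and the a-priori estimate -/

section Induction

open MeasureTheory Metric

/-- A set integral of a power of a bounded nonnegative continuous function on a disc. -/
theorem setIntegral_pow_le_of_le {f : ℂ → ℝ} (hf : Continuous f) (hf0 : ∀ z, 0 ≤ f z) {ρ S : ℝ}
    (hS : ∀ z ∈ closedBall (0 : ℂ) ρ, f z ≤ S) (k : ℕ) :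
    ∫ z in closedBall (0 : ℂ) ρ, f z ^ k ≤ (volume (closedBall (0 : ℂ) ρ)).toReal * S ^ k := by
  calc ∫ z in closedBall (0 : ℂ) ρ, f z ^ k ≤ ∫ _ in closedBall (0 : ℂ) ρ, S ^ k :=
        setIntegral_mono_on (integrableOn_closedBall_of_continuous (hf.pow k) 0 ρ)
          (integrableOn_closedBall_of_continuous continuous_const 0 ρ) measurableSet_closedBall
          fun z hz => pow_le_pow_left₀ (hf0 z) (hS z hz) k
    _ = (volume (closedBall (0 : ℂ) ρ)).toReal * S ^ k := by
        rw [setIntegral_const, smul_eq_mul]; rfl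

/-- Monotonicity of set integrals of nonnegative continuous functions in the radius. -/
theorem setIntegral_closedBall_mono {f : ℂ → ℝ} (hf : Continuous f) (hf0 : ∀ z, 0 ≤ f z) {r₁ r₂ : ℝ}
    (h : r₁ ≤ r₂) : ∫ z in closedBall (0 : ℂ) r₁, f z ≤ ∫ z in closedBall (0 : ℂ) r₂, f z :=
  setIntegral_mono_set (integrableOn_closedBall_of_continuous hf 0 r₂)
    (Filter.Eventually.of_forall fun z => hf0 z) (closedBall_subset_closedBall h).eventuallyLE

/-- Set integrals of squared norms of derivatives are nonnegative. -/
theorem setIntegral_norm_pow_nonneg (g : ℂ → E4) (k p : ℕ) (ρ : ℝ) :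
    0 ≤ ∫ z in closedBall (0 : ℂ) ρ, ‖iteratedFDeriv ℝ k g z‖ ^ p :=
  integral_nonneg fun _ => pow_nonneg (norm_nonneg _) p

/-- **The bootstrapping induction.** With `r t = δ/2 + δ/(2(t+2))` (radii decreasing from `3δ/4`
to `δ/2`), for every `m` there is `S` with `‖Dⁱg‖ ≤ S` on the disc of radius `r (5m)` for all
`i ≤ m + 1` and all admissible `g` (steps `α, α, β, α, γ` per round). -/
theorem bootstrap
    (h1 : ∀ (A₀ : E4 →L[ℝ] E4), (∀ v, A₀ (A₀ v) = -v) → ∀ (W : ℂ → E4), ContDiff ℝ ∞ W →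
      HasCompactSupport W → (∫ z, (‖fderiv ℝ W z 1‖ ^ 2 + ‖fderiv ℝ W z Complex.I‖ ^ 2)) ≤
        (1 + ‖A₀‖ ^ 2) * ∫ z, ‖fderiv ℝ W z Complex.I - A₀ (fderiv ℝ W z 1)‖ ^ 2)
    (hL : ∃ C : ℝ, ∀ (W : ℂ → E4), ContDiff ℝ ∞ W → HasCompactSupport W →
      (∫ z, ‖W z‖ ^ 4) ≤ C * ((∫ z, ‖W z‖ ^ 2) *
        ∫ z, (‖fderiv ℝ W z 1‖ ^ 2 + ‖fderiv ℝ W z Complex.I‖ ^ 2)))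
    (hS : ∀ (W : ℂ → E4), ContDiff ℝ ∞ W → HasCompactSupport W → ∀ z : ℂ,
      ‖W z‖ ≤ ∫ y, ‖fderiv ℝ (fun x => fderiv ℝ W x 1) y Complex.I‖)
    (hB : ∀ (n : ℕ) (T : ContinuousMultilinearMap ℝ (fun _ : Fin n => ℂ) E4),
      ‖T‖ ≤ ∑ L : Fin n → Fin 2, ‖T (fun j => ![(1 : ℂ), Complex.I] (L j))‖)
    {J : E4 → E4 →L[ℝ] E4} (hJs : ContDiff ℝ ∞ J) (hJ2 : ∀ x v, J x (J x v) = -v)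
    {R₀ M₀ M₁ : ℝ} (hM₀ : ∀ x : E4, ‖x‖ ≤ R₀ → ‖J x‖ ≤ M₀)
    (hM₁ : ∀ x : E4, ‖x‖ ≤ R₀ → ‖fderiv ℝ J x‖ ≤ M₁)
    {δ : ℝ} (hδ0 : 0 < δ) (hδ1 : δ ≤ 1) (hδ : 16 * (1 + M₀ ^ 2) * M₁ ^ 2 * δ ^ 2 ≤ 1) (m : ℕ) :
    ∃ S : ℝ, ∀ g : ℂ → E4, ContDiff ℝ ∞ g → IsJHolomorphicFlat J g →
      (∀ z : ℂ, ‖z‖ ≤ 1 → ‖g z‖ ≤ R₀) → (∀ z : ℂ, ‖z‖ ≤ 1 → ‖fderiv ℝ g z‖ ≤ 2) →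
      ∀ i, i ≤ m + 1 → ∀ z : ℂ, ‖z‖ ≤ δ / 2 + δ / (2 * ((5 * m : ℕ) + 2)) →
        ‖iteratedFDeriv ℝ i g z‖ ≤ S := by
  -- the radii
  obtain ⟨r, hr⟩ : ∃ r : ℕ → ℝ, r = fun t : ℕ => δ / 2 + δ / (2 * ((t : ℝ) + 2)) := ⟨_, rfl⟩
  have hr5 : ∀ m : ℕ, r (5 * m) = δ / 2 + δ / (2 * ((5 * m : ℕ) + 2)) := fun m => by rw [hr]
  have hr_pos : ∀ t, 0 < r t := fun t => by rw [hr]; positivity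
  have hr_le : ∀ t, r t ≤ δ := fun t => by
    rw [hr]
    have : δ / (2 * ((t : ℝ) + 2)) ≤ δ / 2 :=
      div_le_div_of_nonneg_left hδ0.le (by norm_num)
        (by nlinarith [(Nat.cast_nonneg t : (0 : ℝ) ≤ t)])
    show δ / 2 + δ / (2 * ((t : ℝ) + 2)) ≤ δ
    linarith
  have hr_anti : ∀ t t' : ℕ, t ≤ t' → r t' ≤ r t := fun t t' htt => by
    rw [hr]
    have : δ / (2 * ((t' : ℝ) + 2)) ≤ δ / (2 * ((t : ℝ) + 2)) :=
      div_le_div_of_nonneg_left hδ0.le (by positivity) (by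
        have : (t : ℝ) ≤ t' := by exact_mod_cast htt
        linarith)
    show δ / 2 + δ / (2 * ((t' : ℝ) + 2)) ≤ δ / 2 + δ / (2 * ((t : ℝ) + 2))
    linarith
  have hr_lt : ∀ t : ℕ, r (t + 1) < r t := fun t => by
    rw [hr]
    have : δ / (2 * (((t + 1 : ℕ) : ℝ) + 2)) < δ / (2 * ((t : ℝ) + 2)) :=
      div_lt_div_of_pos_left hδ0 (by positivity) (by push_cast; linarith)
    show δ / 2 + δ / (2 * (((t + 1 : ℕ) : ℝ) + 2)) < δ / 2 + δ / (2 * ((t : ℝ) + 2))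
    linarith
  have hr1 : ∀ t, r t ≤ 1 := fun t => (hr_le t).trans hδ1
  have hrδ : ∀ t, 16 * (1 + M₀ ^ 2) * M₁ ^ 2 * r t ^ 2 ≤ 1 := fun t => by
    have : r t ^ 2 ≤ δ ^ 2 := pow_le_pow_left₀ (hr_pos t).le (hr_le t) 2
    have h0 : 0 ≤ 16 * (1 + M₀ ^ 2) * M₁ ^ 2 := by positivity
    nlinarith [mul_le_mul_of_nonneg_left this h0]
  -- restate the goal with `r`
  suffices H : ∃ S : ℝ, ∀ g : ℂ → E4, ContDiff ℝ ∞ g → IsJHolomorphicFlat J g →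
      (∀ z : ℂ, ‖z‖ ≤ 1 → ‖g z‖ ≤ R₀) → (∀ z : ℂ, ‖z‖ ≤ 1 → ‖fderiv ℝ g z‖ ≤ 2) →
      ∀ i, i ≤ m + 1 → ∀ z : ℂ, ‖z‖ ≤ r (5 * m) → ‖iteratedFDeriv ℝ i g z‖ ≤ S by
    obtain ⟨S, hS'⟩ := H
    exact ⟨S, fun g hg hgJ hg0 hg1 i hi z hz => hS' g hg hgJ hg0 hg1 i hi z (by rw [hr5]; exact hz)⟩
  induction m with
  | zero =>
    refine ⟨max R₀ 2, fun g hg hgJ hg0 hg1 i hi z hz => ?_⟩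
    have hz1 : ‖z‖ ≤ 1 := hz.trans (hr1 _)
    interval_cases i
    · rw [norm_iteratedFDeriv_zero]; exact (hg0 z hz1).trans (le_max_left _ _)
    · rw [norm_iteratedFDeriv_one_eq]; exact (hg1 z hz1).trans (le_max_right _ _)
  | succ m ih =>
    obtain ⟨S, hSb⟩ := ih
    -- the five steps, with their `g`-independent constants
    have hn1 : 1 ≤ m + 1 := by omega
    obtain ⟨CA, hCA⟩ := alpha h1 hB hJs hJ2 hM₀ hM₁ (n := m + 1) hn1 (hr_pos (5 * m + 1))
      (hr_lt (5 * m)) (hr1 _) (hrδ _) S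
    obtain ⟨CB, hCB⟩ := alpha h1 hB hJs hJ2 hM₀ hM₁ (n := m + 2) (by omega) (hr_pos (5 * m + 2))
      (hr_lt (5 * m + 1)) (hr1 _) (hrδ _) S
    obtain ⟨CC, hCC⟩ := beta hL hB (m + 2) (hr_pos (5 * m + 3)) (hr_lt (5 * m + 2))
    obtain ⟨CD, hCD⟩ := alpha h1 hB hJs hJ2 hM₀ hM₁ (n := m + 3) (by omega) (hr_pos (5 * m + 4))
      (hr_lt (5 * m + 3)) (hr1 _) (hrδ _) S
    obtain ⟨CE, hCE⟩ := gamma hS hB (m + 2) (hr_pos (5 * m + 5)) (hr_lt (5 * m + 4))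
    -- volumes
    obtain ⟨V0, hV0⟩ : ∃ V : ℝ, V = (volume (closedBall (0 : ℂ) (r (5 * m)))).toReal := ⟨_, rfl⟩
    obtain ⟨V1, hV1⟩ : ∃ V : ℝ, V = (volume (closedBall (0 : ℂ) (r (5 * m + 1)))).toReal := ⟨_, rfl⟩
    -- the propagated bounds
    obtain ⟨Q₁, hQ₁⟩ : ∃ Q : ℝ, Q = |CA| * (1 + V0 * (max S |R₀|) ^ 4 + V0 * S ^ 2) := ⟨_, rfl⟩
    obtain ⟨Q₂, hQ₂⟩ : ∃ Q : ℝ, Q = |CB| * (1 + V1 * S ^ 4 + Q₁) := ⟨_, rfl⟩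
    obtain ⟨P, hP⟩ : ∃ Q : ℝ, Q = |CC| * (Q₁ * (Q₂ + Q₁)) := ⟨_, rfl⟩
    obtain ⟨Q₃, hQ₃⟩ : ∃ Q : ℝ, Q = |CD| * (1 + P + Q₂) := ⟨_, rfl⟩
    refine ⟨max S (|CE| * (1 + Q₃ + Q₂ + Q₁)), fun g hg hgJ hg0 hg1 i hi z hz => ?_⟩
    have hac : ∀ k, Continuous fun z => ‖iteratedFDeriv ℝ k g z‖ := fun k =>
      (hg.continuous_iteratedFDeriv (m := k) (by exact_mod_cast le_top)).norm
    have hnn : ∀ (k p : ℕ) (ρ : ℝ), 0 ≤ ∫ z in closedBall (0 : ℂ) ρ, ‖iteratedFDeriv ℝ k g z‖ ^ p :=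
      fun k p ρ => setIntegral_norm_pow_nonneg g k p ρ
    -- sup bounds from the induction hypothesis, on the disc of radius `r (5m)` and inside
    have hsup : ∀ i, i ≤ m + 1 → ∀ t, 5 * m ≤ t → ∀ z ∈ closedBall (0 : ℂ) (r t),
        ‖iteratedFDeriv ℝ i g z‖ ≤ S := fun i hi t ht z hz =>
      hSb g hg hgJ hg0 hg1 i hi z ((mem_closedBall_zero_iff.mp hz).trans (hr_anti _ _ ht))
    -- step A
    have hA : ∫ z in closedBall (0 : ℂ) (r (5 * m + 1)), ‖iteratedFDeriv ℝ (m + 1 + 1) g z‖ ^ 2 ≤ Q₁ := by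
      have h := hCA g hg hgJ hg0 hg1 (fun i hi1 hi2 z hz =>
        hsup i (by omega) (5 * m) le_rfl z (mem_closedBall_zero_iff.mpr hz))
      refine h.trans ?_
      rw [hQ₁]
      have i4 : ∫ z in closedBall (0 : ℂ) (r (5 * m)), ‖iteratedFDeriv ℝ (m + 1 - 1) g z‖ ^ 4 ≤
          V0 * (max S |R₀|) ^ 4 := by
        rw [hV0]
        refine setIntegral_pow_le_of_le (hac (m + 1 - 1)) (fun z => norm_nonneg _) (fun z hz => ?_) 4
        rcases Nat.eq_zero_or_pos m with hm | hm
        · subst hm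
          show ‖iteratedFDeriv ℝ 0 g z‖ ≤ _
          rw [norm_iteratedFDeriv_zero]
          exact ((hg0 z ((mem_closedBall_zero_iff.mp hz).trans (hr1 _))).trans (le_abs_self _)).trans
            (le_max_right _ _)
        · exact (hsup (m + 1 - 1) (by omega) (5 * m) le_rfl z hz).trans (le_max_left _ _)
      have i2 : ∫ z in closedBall (0 : ℂ) (r (5 * m)), ‖iteratedFDeriv ℝ (m + 1) g z‖ ^ 2 ≤
          V0 * S ^ 2 := by
        rw [hV0]
        exact setIntegral_pow_le_of_le (hac _) (fun z => norm_nonneg _)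
          (fun z hz => hsup (m + 1) le_rfl (5 * m) le_rfl z hz) 2
      have hx4 := hnn (m + 1 - 1) 4 (r (5 * m))
      have hx2 := hnn (m + 1) 2 (r (5 * m))
      calc CA * _ ≤ |CA| * _ := mul_le_mul_of_nonneg_right (le_abs_self _) (by linarith)
        _ ≤ _ := mul_le_mul_of_nonneg_left (by linarith) (abs_nonneg _)
    have hQ₁0 : 0 ≤ Q₁ := (hnn _ _ _).trans hA
    -- step B
    have hBstep : ∫ z in closedBall (0 : ℂ) (r (5 * m + 2)), ‖iteratedFDeriv ℝ (m + 2 + 1) g z‖ ^ 2 ≤ Q₂ := by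
      have h := hCB g hg hgJ hg0 hg1 (fun i hi1 hi2 z hz =>
        hsup i (by omega) (5 * m + 1) (by omega) z (mem_closedBall_zero_iff.mpr hz))
      refine h.trans ?_
      rw [hQ₂]
      have i4 : ∫ z in closedBall (0 : ℂ) (r (5 * m + 1)), ‖iteratedFDeriv ℝ (m + 2 - 1) g z‖ ^ 4 ≤
          V1 * S ^ 4 := by
        rw [hV1]
        exact setIntegral_pow_le_of_le (hac _) (fun z => norm_nonneg _)
          (fun z hz => hsup (m + 2 - 1) (by omega) (5 * m + 1) (by omega) z hz) 4
      have hA' : ∫ z in closedBall (0 : ℂ) (r (5 * m + 1)), ‖iteratedFDeriv ℝ (m + 2) g z‖ ^ 2 ≤ Q₁ := hA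
      have hx4 := hnn (m + 2 - 1) 4 (r (5 * m + 1))
      have hx2 := hnn (m + 2) 2 (r (5 * m + 1))
      calc CB * _ ≤ |CB| * _ := mul_le_mul_of_nonneg_right (le_abs_self _) (by linarith)
        _ ≤ _ := mul_le_mul_of_nonneg_left (by linarith) (abs_nonneg _)
    have hQ₂0 : 0 ≤ Q₂ := (hnn _ _ _).trans hBstep
    -- step C
    have hA2 : ∫ z in closedBall (0 : ℂ) (r (5 * m + 2)), ‖iteratedFDeriv ℝ (m + 2) g z‖ ^ 2 ≤ Q₁ :=
      (setIntegral_closedBall_mono ((hac (m + 2)).pow 2) (fun z => pow_nonneg (norm_nonneg _) 2)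
        (hr_lt _).le).trans hA
    have hB2 : ∫ z in closedBall (0 : ℂ) (r (5 * m + 2)), ‖iteratedFDeriv ℝ (m + 2 + 1) g z‖ ^ 2 ≤ Q₂ :=
      hBstep
    have hCstep : ∫ z in closedBall (0 : ℂ) (r (5 * m + 3)), ‖iteratedFDeriv ℝ (m + 2) g z‖ ^ 4 ≤ P := by
      refine (hCC g hg).trans ?_
      rw [hP]
      have hx : (∫ z in closedBall (0 : ℂ) (r (5 * m + 2)), ‖iteratedFDeriv ℝ (m + 2) g z‖ ^ 2) *
          ((∫ z in closedBall (0 : ℂ) (r (5 * m + 2)), ‖iteratedFDeriv ℝ (m + 2 + 1) g z‖ ^ 2) +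
            ∫ z in closedBall (0 : ℂ) (r (5 * m + 2)), ‖iteratedFDeriv ℝ (m + 2) g z‖ ^ 2) ≤
          Q₁ * (Q₂ + Q₁) :=
        mul_le_mul hA2 (add_le_add hB2 hA2) (add_nonneg (hnn _ _ _) (hnn _ _ _)) hQ₁0
      have hpos : 0 ≤ (∫ z in closedBall (0 : ℂ) (r (5 * m + 2)), ‖iteratedFDeriv ℝ (m + 2) g z‖ ^ 2) *
          ((∫ z in closedBall (0 : ℂ) (r (5 * m + 2)), ‖iteratedFDeriv ℝ (m + 2 + 1) g z‖ ^ 2) +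
            ∫ z in closedBall (0 : ℂ) (r (5 * m + 2)), ‖iteratedFDeriv ℝ (m + 2) g z‖ ^ 2) :=
        mul_nonneg (hnn _ _ _) (add_nonneg (hnn _ _ _) (hnn _ _ _))
      calc CC * _ ≤ |CC| * _ := mul_le_mul_of_nonneg_right (le_abs_self _) hpos
        _ ≤ _ := mul_le_mul_of_nonneg_left hx (abs_nonneg _)
    have hP0 : 0 ≤ P := (hnn _ _ _).trans hCstep
    -- step D
    have hDstep : ∫ z in closedBall (0 : ℂ) (r (5 * m + 4)), ‖iteratedFDeriv ℝ (m + 3 + 1) g z‖ ^ 2 ≤ Q₃ := by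
      have h := hCD g hg hgJ hg0 hg1 (fun i hi1 hi2 z hz =>
        hsup i (by omega) (5 * m + 3) (by omega) z (mem_closedBall_zero_iff.mpr hz))
      refine h.trans ?_
      rw [hQ₃]
      have hC3 : ∫ z in closedBall (0 : ℂ) (r (5 * m + 3)), ‖iteratedFDeriv ℝ (m + 3 - 1) g z‖ ^ 4 ≤ P :=
        hCstep
      have hB3 : ∫ z in closedBall (0 : ℂ) (r (5 * m + 3)), ‖iteratedFDeriv ℝ (m + 3) g z‖ ^ 2 ≤ Q₂ :=
        (setIntegral_closedBall_mono ((hac (m + 3)).pow 2) (fun z => pow_nonneg (norm_nonneg _) 2)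
          (hr_lt _).le).trans hBstep
      have hx4 := hnn (m + 3 - 1) 4 (r (5 * m + 3))
      have hx2 := hnn (m + 3) 2 (r (5 * m + 3))
      calc CD * _ ≤ |CD| * _ := mul_le_mul_of_nonneg_right (le_abs_self _) (by linarith)
        _ ≤ _ := mul_le_mul_of_nonneg_left (by linarith) (abs_nonneg _)
    -- step E
    have hEstep : ∀ z ∈ closedBall (0 : ℂ) (r (5 * m + 5)), ‖iteratedFDeriv ℝ (m + 2) g z‖ ≤
        |CE| * (1 + Q₃ + Q₂ + Q₁) := by
      intro z hz
      refine (hCE g hg z hz).trans ?_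
      have hD4 : ∫ z in closedBall (0 : ℂ) (r (5 * m + 4)), ‖iteratedFDeriv ℝ (m + 2 + 2) g z‖ ^ 2 ≤ Q₃ :=
        hDstep
      have hB4 : ∫ z in closedBall (0 : ℂ) (r (5 * m + 4)), ‖iteratedFDeriv ℝ (m + 2 + 1) g z‖ ^ 2 ≤ Q₂ :=
        (setIntegral_closedBall_mono ((hac (m + 2 + 1)).pow 2) (fun z => pow_nonneg (norm_nonneg _) 2)
          (hr_anti _ _ (by omega))).trans hBstep
      have hA4 : ∫ z in closedBall (0 : ℂ) (r (5 * m + 4)), ‖iteratedFDeriv ℝ (m + 2) g z‖ ^ 2 ≤ Q₁ :=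
        (setIntegral_closedBall_mono ((hac (m + 2)).pow 2) (fun z => pow_nonneg (norm_nonneg _) 2)
          (hr_anti _ _ (by omega))).trans hA
      have hx1 := hnn (m + 2 + 2) 2 (r (5 * m + 4))
      have hx2 := hnn (m + 2 + 1) 2 (r (5 * m + 4))
      have hx3 := hnn (m + 2) 2 (r (5 * m + 4))
      calc CE * _ ≤ |CE| * _ := mul_le_mul_of_nonneg_right (le_abs_self _) (by linarith)
        _ ≤ _ := mul_le_mul_of_nonneg_left (by linarith) (abs_nonneg _)
    -- conclusion
    have e5 : 5 * (m + 1) = 5 * m + 5 := by ring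
    rw [e5] at hz
    rcases Nat.lt_or_ge i (m + 2) with hlt | hge
    · exact (hsup i (by omega) (5 * m + 5) (by omega) z (mem_closedBall_zero_iff.mpr hz)).trans
        (le_max_left _ _)
    · have hi2 : i = m + 2 := by omega
      subst hi2
      exact (hEstep z (mem_closedBall_zero_iff.mpr hz)).trans (le_max_right _ _)

end Induction

end Apriori

end Summit.SmoothPoincare4.SmoothPoincare4.Cruxes.TameOrBrodyR4.Sketch
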